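import Mathlib
import Summits.QuantumFields.YangMills.Theorems.BalabanUVNodesN15VectorCarrier
import HarnessLib

/-!
# Route «BalabanUVNodes» (K4 «SpineRates»), node N15 = NE2, BACKGROUND LAYER — THE DRESSED ENTRY 2 `G(U)∇*` WITHOUT THE MIXED PIECE `∇_μG∇_ν*`:
# the tuple carrier `X × J → ℝ`, the lattice product rules, and the CLOSED RIGHT-NEUMANN SYSTEM `E₂∘(1 + K̂) = (1 + E₀R̃)∘(G∘div)` (algebra)

Cell `pub-ymgap`, seat `pub-ymgap-dag-n15-c` (generation g8; R134 ACCELERATION SEAT, strategy s1 = the estimate that is actually missing; HUMAN RULING D-0062; chair R424 venue;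
`bears_on: R4∕N15`).  Filed `--kind proof --supports stmt-QuantumFields-20509 --as helper` (K3⁶ `SpineGivenEndpointR13SepCoPR`, dag-lead WORDS-142; count-neutral).  Imports BY NAME
n15-b's `…N15VectorCarrier` (`liftMap`, `liftBlk`: the product carrier) and through it the currency (`B11SectG.HasMaj`, `T4EtaRateDefect.idef`, `T4EtaRateCoeffDefect.pull`,
`B6Prop26Gluing.mulOp`); nothing in the tree is modified.

WHY (the structural finding of this generation).  The lineage's background-live knit (n15-b B3∕B4, this seat's V0 `hasMaj_entries_of_letters`, F15∕F16 `ne2PlusOperator_vWGC`,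
W4 `uniform_layer_v1M`) dresses the four (3.42) entries through the LEFT Neumann form on the stacked pair space, and its entry 2 `G(U)∇_ν*` is
`pr₀ (1 − ĜV̂)⁻¹(Ĝ∇_ν*)` with `Ĝ∇_ν* = (G∇_ν*, (∇_μG∇_ν*)_μ)` — so it needs a UNIFORM sup-block majorant of the MIXED pieces `∇_μG∇_ν*` (letters `hSD`, `hDSD`).  For
the single-scale vector PIECE that letter is a theorem (g0 F1∕F2); for Bałaban's FULL `U ≡ 1` propagator `G = Δ_b⁻¹` it is FALSE uniformly in the scale: `∇G∇*` is a
zeroth-order singular kernel (`~|x − x′|^{−(d+1)}` inside a unit block at spacing `L^{−k}`), whose sup → sup block norm grows like `log L^k`; the print bounds it only with a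
Hölder norm of the source — [B4-I] (1.112)–(1.113) p.36 (`|∇G∇*J| ≤ O(1)e^{−δ₀|y−y′|}(‖J‖_ε + |J|)`, tree `B5.Ineq110_114` clause 3), [B9] (3.44) p.398.  THE REPAIR is the
print's own RIGHT Neumann form (3.64)–(3.65) p.402, `G′(U′U) = G′(U)(I − V′(A)G′(U))⁻¹ = G′(U) + G′(U′U)V′(A)G′(U)`, followed by LATTICE INTEGRATION BY PARTS in the
first-order coefficients of `V′ = R₀ + M_c + Σ_μ[M_{a_μ}∇_μ + M_{b_μ}∇⁻_μ]`: with `S_μ = pull e_μ` the one-step shift, `∇_μ = n(S_μ − 1)`, `∇_μ* = n(S_μ⁻¹ − 1)`, `∇⁻_μ = −∇_μ*`,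
`C∇_μ = ∇_μC′ − n(C − C′)` when `CS_μ = S_μC′` and `C∇_μ* = ∇_μ*C″ + n(C″ − C)` when `CS_μ⁻¹ = S_μ⁻¹C″` (ANY coefficient operator intertwining the shifts — scalar `M_a`: `M_a∇_μ = ∇_μM_{a∘e⁻¹} − M_{(∇a)∘e⁻¹}`, `M_a∇_μ* = ∇_μ*M_{a∘e} + M_{∇a}` — or fibrewise matrices), `∇_μ = −∇_μ*∘S_μ` (§2), the tuple `E₂_ν = E₀∘∇_ν*` (`E₀ = G(U)` the dressed entry 0) solves
`E₂_ν + Σ_μ E₂_μ∘K̃_μ∘S_ν = S_ν + E₀∘R̃∘S_ν`, `S_ν = G∘∇_ν*`, `K̃_μ = S_μC^a′_μ + C^b″_μ`, `R̃ = R₀ − Σ_μ n[(C^a_μ − C^a′_μ) + (C^b″_μ − C^b_μ)]` (§3 `e2_closed_system`), i.e. on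
the tuple carrier `(Σ_ν E₂_ν pr_ν)∘(1 + K̂) = (1 + E₀R̃)∘(Σ_ν S_ν pr_ν)`, `K̂ = stack_μ (K̃_μ ∘ Σ_ν S_ν pr_ν)` (`sumJ_e2_comp_addId`).  Its letters are ONLY entry 0 (dressed), entry 2
of the `U ≡ 1` pair (`G∇*`), one-step shifts and the coefficient multiplications — NO mixed piece.  The sequel `…N15BackgroundEntry2ByParts` inverts `1 + K̂` by the
lineage's Neumann device and proves the majorant ∕ η-defect ∕ identification.

CONTENTS ([folklore] linear algebra; 10 small defs).
* §1 the tuple carrier `X × J → ℝ` (blocks `liftBlk blk J`, transport `pull (liftMap π J)`): `projJ`, `injJ`, `stackJ`, `sumJ` (+ unfoldings, `sumJ_comp_injJ`, `projJ_stackJ`,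
  `linearMap_sum_comp`∕`linearMap_comp_sum`), the η-defect rules `idef_stackJ`, `idef_sumJ`, and the block-majorant rules `hasMaj_stackJ`, `hasMaj_sumJ`, `hasMaj_sumJ_exp`, `hasMaj_injJ`.
* §2 the lattice calculus for a translation `e : X ≃ X` at spacing `n⁻¹`: `fgrad`, `fgradAdj`, `bgrad` (+ `_apply`), `bgrad_eq_neg_fgradAdj`, `fgrad_eq_neg_fgradAdj_comp_pull`,
  ★ `comp_fgrad_of_intertwine`, ★ `comp_fgradAdj_of_intertwine` (the two product rules for intertwining coefficient operators), scalar instances `mulOp_comp_pull`(`_symm`),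
  `smul_mulOp_sub_eq`(`'`), `mulOp_comp_fgrad`, `mulOp_comp_fgradAdj`.
* §3 the species data `rightPert` (`W = V′Ĝ` of (3.63)–(3.64)), `byPartsMult` (`R̃`), `byPartsFactor` (`K̃_μ`); `e0_comp_fgrad`, `e0_comp_bgrad` (one integration by parts each),
  ★★ `e2_closed_system`, ★★ `sumJ_e2_comp_addId`.

HONEST FRAMING ∕ LIMITS.  Algebra over an abstract lattice `X` with translations `τ_μ : X ≃ X`, abstract operators `G, E₀, R₀` and coefficient operators `C^a_μ, C^b_μ` with their
translates `C^a′_μ, C^b″_μ` (intertwining hypotheses displayed), under the displayed right fixed-point equation `E₀ = G + E₀W`; no estimate here (the sequel carries the block-currency bounds).  NE2⁺ NOT PRINTED, NOT proved, not claimed; count-neutral (typed 28∕28 · discharged 5∕27 of record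
unchanged); N15 NOT discharged; one finite lattice at fixed ε — NOT ℝ⁴, NOT infinite volume, NOT OS, NOT a mass gap, NOT Clay.
-/

noncomputable section

open scoped BigOperators
open Finset

namespace Summit.QuantumFields.YangMills.BalabanUVNodes.N15.BackgroundLayer

open Literature.MathematicalPhysics.QuantumFieldTheory.Balaban1983to89
open Literature.MathematicalPhysics.QuantumFieldTheory.Balaban1983to89.B11SectG (BlockNorm HasMaj)
open Literature.MathematicalPhysics.QuantumFieldTheory.Balaban1983to89.T4EtaRateDefect (idef idef_apply)
open Literature.MathematicalPhysics.QuantumFieldTheory.Balaban1983to89.T4EtaRateCoeffDefect (pull pull_apply diagK diagK_nonneg)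
open Literature.MathematicalPhysics.QuantumFieldTheory.Balaban1983to89.B6Prop26Gluing (mulOp mulOp_apply)
open Literature.MathematicalPhysics.QuantumFieldTheory.Balaban1983to89.B11AxialTransport190 (abs_le_loc_ofBlocks loc_ofBlocks_le)
open Summit.QuantumFields.YangMills.BalabanUVNodes.N15.MatrixSpecies (liftMap liftBlk)

/-! ## §1 The tuple carrier `X × J → ℝ`: projections, injections, stacks, sums -/

section Tuple

variable {X X' J : Type} {F₁ F₂ F₁' F₂' : Type} [AddCommGroup F₁] [Module ℝ F₁] [AddCommGroup F₂] [Module ℝ F₂]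
  [AddCommGroup F₁'] [Module ℝ F₁'] [AddCommGroup F₂'] [Module ℝ F₂']

/-- The `ν`-th component of a `J`-tuple of lattice functions: `(pr_ν u)(x) = u(x, ν)`. [folklore] -/
def projJ (ν : J) : (X × J → ℝ) →ₗ[ℝ] (X → ℝ) := pull fun x => (x, ν)

/-- Unfolding. [folklore] -/
@[simp] theorem projJ_apply (ν : J) (u : X × J → ℝ) (x : X) : projJ ν u x = u (x, ν) := rfl

/-- The `ν`-th coordinate injection of a lattice function into the `J`-tuples: `(ι_ν f)(x, μ) = [μ = ν]·f(x)`. [folklore] -/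
def injJ [DecidableEq J] (ν : J) : (X → ℝ) →ₗ[ℝ] (X × J → ℝ) where
  toFun f p := if p.2 = ν then f p.1 else 0
  map_add' f f' := funext fun p => by by_cases h : p.2 = ν <;> simp [h]
  map_smul' c f := funext fun p => by by_cases h : p.2 = ν <;> simp [h]

/-- Unfolding. [folklore] -/
@[simp] theorem injJ_apply [DecidableEq J] (ν : J) (f : X → ℝ) (p : X × J) : injJ ν f p = if p.2 = ν then f p.1 else 0 := rfl

/-- The STACK of a `J`-indexed family of operators into lattice functions: `(stack T v)(x, μ) = (T_μ v)(x)`. [folklore] -/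
def stackJ (T : J → (F₁ →ₗ[ℝ] (X → ℝ))) : F₁ →ₗ[ℝ] (X × J → ℝ) where
  toFun v p := T p.2 v p.1
  map_add' v w := funext fun p => by simp
  map_smul' c v := funext fun p => by simp

/-- Unfolding. [folklore] -/
@[simp] theorem stackJ_apply (T : J → (F₁ →ₗ[ℝ] (X → ℝ))) (v : F₁) (p : X × J) : stackJ T v p = T p.2 v p.1 := rfl

/-- The components of a stack are its rows: `pr_μ (stack T v) = T_μ v`. [folklore] -/
@[simp] theorem projJ_stackJ (T : J → (F₁ →ₗ[ℝ] (X → ℝ))) (μ : J) (v : F₁) : projJ μ (stackJ T v) = T μ v := rfl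

/-- Sums of linear maps compose on the right termwise. [folklore] -/
theorem linearMap_sum_comp [Fintype J] {F₃ : Type} [AddCommGroup F₃] [Module ℝ F₃] (T : J → (F₂ →ₗ[ℝ] F₃)) (S : F₁ →ₗ[ℝ] F₂) :
    (∑ μ, T μ) ∘ₗ S = ∑ μ, T μ ∘ₗ S :=
  LinearMap.ext fun v => by simp only [LinearMap.comp_apply, LinearMap.sum_apply]

/-- Sums of linear maps compose on the left termwise. [folklore] -/
theorem linearMap_comp_sum [Fintype J] {F₃ : Type} [AddCommGroup F₃] [Module ℝ F₃] (S : F₂ →ₗ[ℝ] F₃) (T : J → (F₁ →ₗ[ℝ] F₂)) :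
    S ∘ₗ (∑ μ, T μ) = ∑ μ, S ∘ₗ T μ :=
  LinearMap.ext fun v => by simp only [LinearMap.comp_apply, LinearMap.sum_apply, map_sum]

/-- The SUM of a `J`-indexed family of operators on lattice functions over the components of a tuple: `Σ_ν S_ν ∘ pr_ν` (a divergence-type operator
when `S_ν = G∘∇_ν*`). [folklore] -/
def sumJ [Fintype J] (S : J → ((X → ℝ) →ₗ[ℝ] F₂)) : (X × J → ℝ) →ₗ[ℝ] F₂ := ∑ ν, S ν ∘ₗ projJ ν

/-- Unfolding. [folklore] -/
theorem sumJ_apply [Fintype J] (S : J → ((X → ℝ) →ₗ[ℝ] F₂)) (u : X × J → ℝ) : sumJ S u = ∑ ν, S ν (projJ ν u) := by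
  simp [sumJ, LinearMap.sum_apply]

/-- `pr_μ ∘ ι_ν = [μ = ν]`. [folklore] -/
theorem projJ_injJ [DecidableEq J] (μ ν : J) (f : X → ℝ) : projJ μ (injJ (X := X) ν f) = if μ = ν then f else 0 := by
  funext x
  by_cases h : μ = ν <;> simp [h]

/-- `(Σ_μ S_μ pr_μ) ∘ ι_ν = S_ν`. [folklore] -/
theorem sumJ_comp_injJ [Fintype J] [DecidableEq J] (S : J → ((X → ℝ) →ₗ[ℝ] F₂)) (ν : J) : sumJ S ∘ₗ injJ ν = S ν := by
  refine LinearMap.ext fun f => ?_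
  rw [LinearMap.comp_apply, sumJ_apply, Finset.sum_eq_single ν (fun μ _ hμ => by rw [projJ_injJ, if_neg hμ, map_zero])
    (fun h => absurd (Finset.mem_univ ν) h), projJ_injJ, if_pos rfl]

/-- The components commute with the transports: `pr_ν ∘ (pull π̂) = (pull π) ∘ pr_ν`, `π̂ = liftMap π J`. [folklore] -/
@[simp] theorem projJ_pull_liftMap (π : X' → X) (ν : J) (u : X × J → ℝ) : projJ ν (pull (liftMap π J) u) = pull π (projJ ν u) := rfl

/-- THE η-DEFECT OF A STACK IS THE STACK OF THE η-DEFECTS (through `pull (liftMap π J)` on the tuple side). [folklore] -/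
theorem idef_stackJ (τ₁ : F₁ →ₗ[ℝ] F₁') (π : X' → X) (T' : J → (F₁' →ₗ[ℝ] (X' → ℝ))) (T : J → (F₁ →ₗ[ℝ] (X → ℝ))) :
    idef τ₁ (pull (liftMap π J)) (stackJ T') (stackJ T) = stackJ fun μ => idef τ₁ (pull π) (T' μ) (T μ) :=
  LinearMap.ext fun _ => funext fun _ => rfl

/-- THE η-DEFECT OF A COMPONENT SUM IS THE COMPONENT SUM OF THE η-DEFECTS. [folklore] -/
theorem idef_sumJ [Fintype J] (π : X' → X) (τ₂ : F₂ →ₗ[ℝ] F₂') (S' : J → ((X' → ℝ) →ₗ[ℝ] F₂')) (S : J → ((X → ℝ) →ₗ[ℝ] F₂)) :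
    idef (pull (liftMap π J)) τ₂ (sumJ S') (sumJ S) = sumJ fun ν => idef (pull π) τ₂ (S' ν) (S ν) := by
  refine LinearMap.ext fun u => ?_
  simp only [idef_apply, sumJ_apply, map_sum, projJ_pull_liftMap, Finset.sum_sub_distrib]

variable [Fintype X] [Fintype X'] [Fintype J] {g : B6.Geometry} (blk : X → g.Site)

/-- A component of a tuple localised in a block is localised in that block … [folklore] -/
theorem isLoc_projJ {y' : g.Site} {u : X × J → ℝ} (hu : (BlockNorm.ofBlocks g (liftBlk blk J)).IsLoc y' u) (ν : J) :
    (BlockNorm.ofBlocks g blk).IsLoc y' (projJ ν u) :=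
  fun x hx => hu (x, ν) hx

/-- … and is not larger there. [folklore] -/
theorem loc_projJ_le (u : X × J → ℝ) (ν : J) (y' : g.Site) :
    (BlockNorm.ofBlocks g blk).loc y' (projJ ν u) ≤ (BlockNorm.ofBlocks g (liftBlk blk J)).loc y' u :=
  loc_ofBlocks_le blk _ ((BlockNorm.ofBlocks g (liftBlk blk J)).loc_nonneg y' u) fun x hx =>
    abs_le_loc_ofBlocks (liftBlk blk J) u (x' := (x, ν)) hx

/-- A STACK KEEPS A COMMON BLOCK MAJORANT of its rows (`K ≥ 0`). [folklore] -/
theorem hasMaj_stackJ {b₁ : BlockNorm g F₁} {T : J → (F₁ →ₗ[ℝ] (X → ℝ))} {K : g.Site → g.Site → ℝ} (hK : ∀ y y', 0 ≤ K y y')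
    (h : ∀ μ, HasMaj b₁ (BlockNorm.ofBlocks g blk) (T μ) K) : HasMaj b₁ (BlockNorm.ofBlocks g (liftBlk blk J)) (stackJ T) K := by
  intro y' v hv y
  refine loc_ofBlocks_le (liftBlk blk J) _ (mul_nonneg (hK y y') (b₁.loc_nonneg y' v)) fun p hp => ?_
  exact (abs_le_loc_ofBlocks blk (T p.2 v) hp).trans (h p.2 y' v hv y)

/-- A COMPONENT SUM HAS THE SUM OF THE COMPONENTS' BLOCK MAJORANTS (`K_ν ≥ 0`). [folklore] -/
theorem hasMaj_sumJ {b₂ : BlockNorm g F₂} {S : J → ((X → ℝ) →ₗ[ℝ] F₂)} {K : J → g.Site → g.Site → ℝ} (hK : ∀ ν y y', 0 ≤ K ν y y')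
    (h : ∀ ν, HasMaj (BlockNorm.ofBlocks g blk) b₂ (S ν) (K ν)) :
    HasMaj (BlockNorm.ofBlocks g (liftBlk blk J)) b₂ (sumJ S) (fun y y' => ∑ ν, K ν y y') := by
  intro y' u hu y
  rw [sumJ_apply, Finset.sum_mul]
  refine (b₂.loc_sum_le y _ _).trans (Finset.sum_le_sum fun ν _ => ?_)
  exact (h ν y' _ (isLoc_projJ blk hu ν) y).trans (mul_le_mul_of_nonneg_left (loc_projJ_le blk u ν y') (hK ν y y'))

/-- A component sum of operators with a COMMON exponential majorant `a·e^{−δd}` has `|J|·a·e^{−δd}`. [folklore] -/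
theorem hasMaj_sumJ_exp {b₂ : BlockNorm g F₂} {S : J → ((X → ℝ) →ₗ[ℝ] F₂)} {a δ : ℝ} (ha : 0 ≤ a)
    (h : ∀ ν, HasMaj (BlockNorm.ofBlocks g blk) b₂ (S ν) (fun y y' => a * Real.exp (-(δ * g.dist y y')))) :
    HasMaj (BlockNorm.ofBlocks g (liftBlk blk J)) b₂ (sumJ S) (fun y y' => Fintype.card J * a * Real.exp (-(δ * g.dist y y'))) := by
  refine (hasMaj_sumJ blk (fun _ _ _ => mul_nonneg ha (Real.exp_nonneg _)) h).mono fun y y' => le_of_eq ?_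
  rw [Finset.sum_const, Finset.card_univ, nsmul_eq_mul]
  ring

/-- The coordinate injection is a contraction between the sharp block norms (`diagK 1`). [folklore] -/
theorem hasMaj_injJ [DecidableEq J] (ν : J) :
    HasMaj (BlockNorm.ofBlocks g blk) (BlockNorm.ofBlocks g (liftBlk blk J)) (injJ ν) (diagK fun _ => 1) := by
  classical
  intro y' f hf y
  refine loc_ofBlocks_le (liftBlk blk J) _ (mul_nonneg (diagK_nonneg (fun _ => zero_le_one) _ _) ((BlockNorm.ofBlocks g blk).loc_nonneg y' f))
    fun p hp => ?_
  rw [injJ_apply]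
  by_cases hμ : p.2 = ν
  · rw [if_pos hμ]
    by_cases hy : y = y'
    · subst hy
      rw [T4EtaRateCoeffDefect.diagK_same, one_mul]
      exact abs_le_loc_ofBlocks blk f hp
    · have hp' : blk p.1 ≠ y' := by rw [show blk p.1 = y from hp]; exact hy
      rw [hf p.1 hp', abs_zero]
      exact mul_nonneg (diagK_nonneg (fun _ => zero_le_one) _ _) ((BlockNorm.ofBlocks g blk).loc_nonneg y' f)
  · rw [if_neg hμ, abs_zero]
    exact mul_nonneg (diagK_nonneg (fun _ => zero_le_one) _ _) ((BlockNorm.ofBlocks g blk).loc_nonneg y' f)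

end Tuple

/-! ## §2 The lattice calculus of one-step shifts: difference quotients and the product rules (integration by parts) for INTERTWINING coefficient operators -/

section Calculus

variable {X : Type}

/-- The forward difference quotient along a lattice translation `e` at spacing `n⁻¹`: `(∇f)(x) = n·(f(e x) − f(x))`. [cite: Balaban1984PropagatorsI, (1.3) p.18 (lattice derivative: shape)] -/
def fgrad (n : ℝ) (e : X ≃ X) : (X → ℝ) →ₗ[ℝ] (X → ℝ) := n • (pull e - LinearMap.id)

/-- Its adjoint (for the counting measure): `(∇*f)(x) = n·(f(e⁻¹ x) − f(x))`. [cite: Balaban1984PropagatorsI, (1.3) p.18 (shape)] -/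
def fgradAdj (n : ℝ) (e : X ≃ X) : (X → ℝ) →ₗ[ℝ] (X → ℝ) := n • (pull e.symm - LinearMap.id)

/-- The backward difference quotient `(∇⁻f)(x) = n·(f(x) − f(e⁻¹ x)) = (S_{−}∇f)(x)`. [cite: Balaban1985BackgroundPropagators, (3.52) p.400 (the backward covariant derivative: shape)] -/
def bgrad (n : ℝ) (e : X ≃ X) : (X → ℝ) →ₗ[ℝ] (X → ℝ) := n • (LinearMap.id - pull e.symm)

/-- Unfolding. [folklore] -/
@[simp] theorem fgrad_apply (n : ℝ) (e : X ≃ X) (f : X → ℝ) (x : X) : fgrad n e f x = n * (f (e x) - f x) := by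
  simp [fgrad]

/-- Unfolding. [folklore] -/
@[simp] theorem fgradAdj_apply (n : ℝ) (e : X ≃ X) (f : X → ℝ) (x : X) : fgradAdj n e f x = n * (f (e.symm x) - f x) := by
  simp [fgradAdj]

/-- Unfolding. [folklore] -/
@[simp] theorem bgrad_apply (n : ℝ) (e : X ≃ X) (f : X → ℝ) (x : X) : bgrad n e f x = n * (f x - f (e.symm x)) := by
  simp [bgrad]

/-- `∇⁻ = −∇*`. [folklore] -/
theorem bgrad_eq_neg_fgradAdj (n : ℝ) (e : X ≃ X) : bgrad n e = -fgradAdj n e := by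
  refine LinearMap.ext fun f => funext fun x => ?_
  simp only [bgrad_apply, LinearMap.neg_apply, Pi.neg_apply, fgradAdj_apply]
  ring

/-- `∇ = −∇* ∘ S` (`S = pull e`, the one-step shift): `n(f(ex) − f(x)) = −n((Sf)(e⁻¹x) − (Sf)(x))`. [folklore] -/
theorem fgrad_eq_neg_fgradAdj_comp_pull (n : ℝ) (e : X ≃ X) : fgrad n e = -(fgradAdj n e ∘ₗ pull e) := by
  refine LinearMap.ext fun f => funext fun x => ?_
  simp only [fgrad_apply, LinearMap.neg_apply, Pi.neg_apply, LinearMap.comp_apply, fgradAdj_apply, pull_apply, Equiv.apply_symm_apply]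
  ring

/-- **THE LATTICE PRODUCT RULE, forward**, for a coefficient operator `C` INTERTWINING the shift, `C∘S = S∘C′` (`C′` = the coefficient translated by `e⁻¹`; scalar, matrix or any
fibrewise coefficient): `C∘∇ = ∇∘C′ − n·(C − C′)` — for `C = M_a`: `M_a∇ = ∇M_{a∘e⁻¹} − M_{(∇a)∘e⁻¹}`. [folklore] -/
theorem comp_fgrad_of_intertwine (n : ℝ) (e : X ≃ X) {C C' : (X → ℝ) →ₗ[ℝ] (X → ℝ)} (hC : C ∘ₗ pull e = pull e ∘ₗ C') :
    C ∘ₗ fgrad n e = fgrad n e ∘ₗ C' - n • (C - C') := by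
  refine LinearMap.ext fun f => ?_
  have hC' := LinearMap.congr_fun hC f
  simp only [LinearMap.comp_apply] at hC'
  simp only [fgrad, LinearMap.comp_apply, LinearMap.smul_apply, LinearMap.sub_apply, LinearMap.id_apply, map_smul, map_sub, hC', smul_sub]
  abel

/-- **THE LATTICE PRODUCT RULE, adjoint**, for `C∘S⁻¹ = S⁻¹∘C″` (`C″` = the coefficient translated by `e`): `C∘∇* = ∇*∘C″ + n·(C″ − C)` — for `C = M_a`:
`M_a∇* = ∇*M_{a∘e} + M_{∇a}`. [folklore] -/
theorem comp_fgradAdj_of_intertwine (n : ℝ) (e : X ≃ X) {C C'' : (X → ℝ) →ₗ[ℝ] (X → ℝ)} (hC : C ∘ₗ pull e.symm = pull e.symm ∘ₗ C'') :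
    C ∘ₗ fgradAdj n e = fgradAdj n e ∘ₗ C'' + n • (C'' - C) := by
  refine LinearMap.ext fun f => ?_
  have hC' := LinearMap.congr_fun hC f
  simp only [LinearMap.comp_apply] at hC'
  simp only [fgradAdj, LinearMap.comp_apply, LinearMap.smul_apply, LinearMap.add_apply, LinearMap.sub_apply, LinearMap.id_apply, map_smul, map_sub, hC', smul_sub]
  abel

/-- A scalar multiplication operator intertwines the shift with the translated coefficient: `M_a∘S = S∘M_{a∘e⁻¹}`. [folklore] -/
theorem mulOp_comp_pull (a : X → ℝ) (e : X ≃ X) : mulOp a ∘ₗ pull e = pull e ∘ₗ mulOp (a ∘ e.symm) := by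
  refine LinearMap.ext fun f => funext fun x => ?_
  simp only [LinearMap.comp_apply, mulOp_apply, pull_apply, Function.comp_apply, Equiv.symm_apply_apply]

/-- … and the inverse shift: `M_a∘S⁻¹ = S⁻¹∘M_{a∘e}`. [folklore] -/
theorem mulOp_comp_pull_symm (a : X → ℝ) (e : X ≃ X) : mulOp a ∘ₗ pull e.symm = pull e.symm ∘ₗ mulOp (a ∘ e) := by
  refine LinearMap.ext fun f => funext fun x => ?_
  simp only [LinearMap.comp_apply, mulOp_apply, pull_apply, Function.comp_apply, Equiv.apply_symm_apply]

/-- The scalar defect term is the multiplication by the translated derivative: `n·(M_a − M_{a∘e⁻¹}) = M_{(∇a)∘e⁻¹}`. [folklore] -/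
theorem smul_mulOp_sub_eq (n : ℝ) (e : X ≃ X) (a : X → ℝ) : n • (mulOp a - mulOp (a ∘ e.symm)) = mulOp (fgrad n e a ∘ e.symm) := by
  refine LinearMap.ext fun f => funext fun x => ?_
  simp only [LinearMap.smul_apply, LinearMap.sub_apply, Pi.smul_apply, Pi.sub_apply, mulOp_apply, Function.comp_apply, fgrad_apply, Equiv.apply_symm_apply,
    smul_eq_mul]
  ring

/-- … and on the other side: `n·(M_{a∘e} − M_a) = M_{∇a}`. [folklore] -/
theorem smul_mulOp_sub_eq' (n : ℝ) (e : X ≃ X) (a : X → ℝ) : n • (mulOp (a ∘ e) - mulOp a) = mulOp (fgrad n e a) := by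
  refine LinearMap.ext fun f => funext fun x => ?_
  simp only [LinearMap.smul_apply, LinearMap.sub_apply, Pi.smul_apply, Pi.sub_apply, mulOp_apply, Function.comp_apply, fgrad_apply, smul_eq_mul]
  ring

/-- THE SCALAR PRODUCT RULES as instances: `M_a∇ = ∇M_{a∘e⁻¹} − M_{(∇a)∘e⁻¹}` … [folklore] -/
theorem mulOp_comp_fgrad (n : ℝ) (e : X ≃ X) (a : X → ℝ) :
    mulOp a ∘ₗ fgrad n e = fgrad n e ∘ₗ mulOp (a ∘ e.symm) - mulOp (fgrad n e a ∘ e.symm) := by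
  rw [comp_fgrad_of_intertwine n e (mulOp_comp_pull a e), smul_mulOp_sub_eq]

/-- … and `M_a∇* = ∇*M_{a∘e} + M_{∇a}`. [folklore] -/
theorem mulOp_comp_fgradAdj (n : ℝ) (e : X ≃ X) (a : X → ℝ) :
    mulOp a ∘ₗ fgradAdj n e = fgradAdj n e ∘ₗ mulOp (a ∘ e) + mulOp (fgrad n e a) := by
  rw [comp_fgradAdj_of_intertwine n e (mulOp_comp_pull_symm a e), smul_mulOp_sub_eq']

end Calculus

/-! ## §3 The CLOSED RIGHT-NEUMANN SYSTEM for the dressed entry 2, with NO mixed piece -/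

section Identification

variable {X J : Type} [Fintype J] [DecidableEq J]
variable (τ : J → X ≃ X) (n : ℝ) (G E0 R₀ : (X → ℝ) →ₗ[ℝ] (X → ℝ)) (Ca Ca' Cb Cb'' : J → ((X → ℝ) →ₗ[ℝ] (X → ℝ)))

/-- THE RIGHT PERTURBATION `W = V′Ĝ` of the first-order species `V′ = R₀ + Σ_μ [C^a_μ∇_μ + C^b_μ∇⁻_μ]` (zeroth-order part `R₀`, forward∕backward coefficient operators `C^a_μ`,
`C^b_μ` — scalar `M_{a_μ}` or fibrewise matrices) acting AFTER the propagator: `W = R₀G + Σ_μ (C^a_μ∇_μG + C^b_μ∇⁻_μG)` — the operator of (3.63)–(3.64).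
[cite: Balaban1985BackgroundPropagators, (3.52) p.400 (species) + (3.63)–(3.64) p.402 (V′(A)G′(U))] -/
def rightPert : (X → ℝ) →ₗ[ℝ] (X → ℝ) :=
  R₀ ∘ₗ G + ∑ μ, (Ca μ ∘ₗ fgrad n (τ μ) ∘ₗ G + Cb μ ∘ₗ bgrad n (τ μ) ∘ₗ G)

/-- THE BY-PARTS MULTIPLIER `R̃ = R₀ − Σ_μ n·[(C^a_μ − C^a′_μ) + (C^b″_μ − C^b_μ)]` (zeroth-order remainder of the integrations by parts; scalar case:
`R₀ − Σ_μ[M_{(∇a_μ)∘e_μ⁻¹} + M_{∇b_μ}]`). [folklore] -/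
def byPartsMult : (X → ℝ) →ₗ[ℝ] (X → ℝ) :=
  R₀ - ∑ μ, n • ((Ca μ - Ca' μ) + (Cb'' μ - Cb μ))

/-- THE BY-PARTS RIGHT FACTORS `K̃_μ = S_μ∘C^a′_μ + C^b″_μ` (shift + translated coefficients). [folklore] -/
def byPartsFactor (μ : J) : (X → ℝ) →ₗ[ℝ] (X → ℝ) :=
  pull (τ μ) ∘ₗ Ca' μ + Cb'' μ

variable {τ n G E0 R₀ Ca Ca' Cb Cb''}

omit [Fintype J] [DecidableEq J] in
/-- ONE INTEGRATION BY PARTS, forward coefficient (`C^a_μS_μ = S_μC^a′_μ`): `E₀C^a_μ∇_μ = −(E₀∇_μ*)∘S_μ∘C^a′_μ − E₀∘n(C^a_μ − C^a′_μ)`. [folklore] -/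
theorem e0_comp_fgrad {μ : J} (hCa : Ca μ ∘ₗ pull (τ μ) = pull (τ μ) ∘ₗ Ca' μ) :
    E0 ∘ₗ Ca μ ∘ₗ fgrad n (τ μ) = -((E0 ∘ₗ fgradAdj n (τ μ)) ∘ₗ pull (τ μ) ∘ₗ Ca' μ) - E0 ∘ₗ (n • (Ca μ - Ca' μ)) := by
  rw [comp_fgrad_of_intertwine n (τ μ) hCa, LinearMap.comp_sub, ← LinearMap.comp_assoc, fgrad_eq_neg_fgradAdj_comp_pull]
  simp only [LinearMap.neg_comp, LinearMap.comp_neg, LinearMap.comp_assoc]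

omit [Fintype J] [DecidableEq J] in
/-- ONE INTEGRATION BY PARTS, backward coefficient (`C^b_μS_μ⁻¹ = S_μ⁻¹C^b″_μ`): `E₀C^b_μ∇⁻_μ = −(E₀∇_μ*)∘C^b″_μ − E₀∘n(C^b″_μ − C^b_μ)`. [folklore] -/
theorem e0_comp_bgrad {μ : J} (hCb : Cb μ ∘ₗ pull (τ μ).symm = pull (τ μ).symm ∘ₗ Cb'' μ) :
    E0 ∘ₗ Cb μ ∘ₗ bgrad n (τ μ) = -((E0 ∘ₗ fgradAdj n (τ μ)) ∘ₗ Cb'' μ) - E0 ∘ₗ (n • (Cb'' μ - Cb μ)) := by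
  rw [bgrad_eq_neg_fgradAdj, LinearMap.comp_neg, comp_fgradAdj_of_intertwine n (τ μ) hCb, LinearMap.comp_neg, LinearMap.comp_add, ← LinearMap.comp_assoc]
  abel

omit [DecidableEq J] in
/-- **THE CLOSED SYSTEM FOR ENTRY 2** (per direction `ν`): if the dressed propagator solves the RIGHT fixed-point equation `E₀ = G + E₀∘W` ((3.65) right form,
`W = V′Ĝ`) and the coefficients intertwine the shifts, then `E₂_ν := E₀∘∇_ν*` satisfies `E₂_ν + Σ_μ E₂_μ∘K̃_μ∘S_ν = S_ν + E₀∘R̃∘S_ν`, `S_ν = G∘∇_ν*` — the mixed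
pieces `∇_μG∇_ν*` never appear. [cite: Balaban1985BackgroundPropagators, (3.64)–(3.65) p.402 (mechanism); the integration by parts is ours] -/
theorem e2_closed_system (hE0 : E0 = G + E0 ∘ₗ rightPert τ n G R₀ Ca Cb) (hCa : ∀ μ, Ca μ ∘ₗ pull (τ μ) = pull (τ μ) ∘ₗ Ca' μ)
    (hCb : ∀ μ, Cb μ ∘ₗ pull (τ μ).symm = pull (τ μ).symm ∘ₗ Cb'' μ) (ν : J) :
    E0 ∘ₗ fgradAdj n (τ ν) + ∑ μ, (E0 ∘ₗ fgradAdj n (τ μ)) ∘ₗ byPartsFactor τ Ca' Cb'' μ ∘ₗ (G ∘ₗ fgradAdj n (τ ν)) =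
      G ∘ₗ fgradAdj n (τ ν) + E0 ∘ₗ byPartsMult n R₀ Ca Ca' Cb Cb'' ∘ₗ (G ∘ₗ fgradAdj n (τ ν)) := by
  have hstep : E0 ∘ₗ fgradAdj n (τ ν) = G ∘ₗ fgradAdj n (τ ν) + E0 ∘ₗ (rightPert τ n G R₀ Ca Cb ∘ₗ fgradAdj n (τ ν)) := by
    conv_lhs => rw [hE0]
    rw [LinearMap.add_comp, LinearMap.comp_assoc]
  -- expand `W ∘ ∇_ν*` and integrate by parts in each `μ`
  have hW : E0 ∘ₗ (rightPert τ n G R₀ Ca Cb ∘ₗ fgradAdj n (τ ν)) =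
      E0 ∘ₗ R₀ ∘ₗ (G ∘ₗ fgradAdj n (τ ν)) +
        ∑ μ, (-((E0 ∘ₗ fgradAdj n (τ μ)) ∘ₗ pull (τ μ) ∘ₗ Ca' μ) - E0 ∘ₗ (n • (Ca μ - Ca' μ)) +
          (-((E0 ∘ₗ fgradAdj n (τ μ)) ∘ₗ Cb'' μ) - E0 ∘ₗ (n • (Cb'' μ - Cb μ)))) ∘ₗ (G ∘ₗ fgradAdj n (τ ν)) := by
    rw [rightPert]
    simp only [LinearMap.add_comp, LinearMap.comp_add, linearMap_sum_comp, linearMap_comp_sum, LinearMap.comp_assoc]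
    refine congrArg _ (Finset.sum_congr rfl fun μ _ => ?_)
    rw [show E0 ∘ₗ Ca μ ∘ₗ fgrad n (τ μ) ∘ₗ G ∘ₗ fgradAdj n (τ ν) = (E0 ∘ₗ Ca μ ∘ₗ fgrad n (τ μ)) ∘ₗ (G ∘ₗ fgradAdj n (τ ν)) by
        simp only [LinearMap.comp_assoc], e0_comp_fgrad (hCa μ),
      show E0 ∘ₗ Cb μ ∘ₗ bgrad n (τ μ) ∘ₗ G ∘ₗ fgradAdj n (τ ν) = (E0 ∘ₗ Cb μ ∘ₗ bgrad n (τ μ)) ∘ₗ (G ∘ₗ fgradAdj n (τ ν)) by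
        simp only [LinearMap.comp_assoc], e0_comp_bgrad (hCb μ)]
    simp only [LinearMap.comp_assoc]
  rw [hstep, hW]
  simp only [byPartsMult, byPartsFactor, LinearMap.add_comp, LinearMap.comp_add, LinearMap.sub_comp, LinearMap.comp_sub, linearMap_sum_comp, linearMap_comp_sum,
    LinearMap.neg_comp, LinearMap.comp_smul, LinearMap.smul_comp, smul_add, smul_sub, LinearMap.comp_assoc, Finset.sum_add_distrib, Finset.sum_sub_distrib,
    Finset.sum_neg_distrib]
  abel

omit [DecidableEq J] in
/-- **THE CLOSED SYSTEM ON THE TUPLE CARRIER**: `(Σ_ν E₂_ν pr_ν) ∘ (1 + K̂) = B̂` with `K̂ = stack_μ (K̃_μ ∘ Σ_ν S_ν pr_ν)`, `B̂ = (1 + E₀R̃) ∘ Σ_ν S_ν pr_ν`. [folklore] -/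
theorem sumJ_e2_comp_addId (hE0 : E0 = G + E0 ∘ₗ rightPert τ n G R₀ Ca Cb) (hCa : ∀ μ, Ca μ ∘ₗ pull (τ μ) = pull (τ μ) ∘ₗ Ca' μ)
    (hCb : ∀ μ, Cb μ ∘ₗ pull (τ μ).symm = pull (τ μ).symm ∘ₗ Cb'' μ) :
    sumJ (fun ν => E0 ∘ₗ fgradAdj n (τ ν)) ∘ₗ (LinearMap.id + stackJ fun μ => byPartsFactor τ Ca' Cb'' μ ∘ₗ sumJ fun ν => G ∘ₗ fgradAdj n (τ ν)) =
      sumJ (fun ν => G ∘ₗ fgradAdj n (τ ν)) + E0 ∘ₗ byPartsMult n R₀ Ca Ca' Cb Cb'' ∘ₗ sumJ fun ν => G ∘ₗ fgradAdj n (τ ν) := by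
  refine LinearMap.ext fun u => ?_
  have key := fun ν => LinearMap.congr_fun (e2_closed_system hE0 hCa hCb ν) (projJ ν u)
  simp only [LinearMap.add_apply, LinearMap.sum_apply, LinearMap.comp_apply] at key
  have hsum := Finset.sum_congr rfl fun ν (_ : ν ∈ Finset.univ) => key ν
  rw [Finset.sum_add_distrib, Finset.sum_add_distrib, Finset.sum_comm] at hsum
  simp only [LinearMap.comp_apply, LinearMap.add_apply, LinearMap.id_apply, map_add, sumJ_apply, projJ_stackJ, map_sum]
  simpa only [LinearMap.comp_apply, sumJ_apply, map_sum] using hsum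

end Identification

end Summit.QuantumFields.YangMills.BalabanUVNodes.N15.BackgroundLayer

end
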